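import Summits.BirchSwinnertonDyer.BirchSwinnertonDyer.Theses.ClassRecordThree
import Summits.BirchSwinnertonDyer.BirchSwinnertonDyer.Theses.KolyvaginRoadThree
import Summits.BirchSwinnertonDyer.BirchSwinnertonDyer.Theorems.ClassRecordThreeEulerHalvesAtThreeFromUBNotRam
import Summits.BirchSwinnertonDyer.BirchSwinnertonDyer.Theorems.ClassRecordThreeBDPValueAtThreeLZZKernel
import HarnessLib

/-!
# Crux `EulerHalvesAtThree` (item stmt-BirchSwinnertonDyer-19109) BY NAME on BOTH @3 routes (`ClassRecordThree` binder h₄,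
# `KolyvaginRoadThree` binder h₅) from UB∃ᴮ@3 on X11b@3 + the route's published-inputs item + the JSW control fact +
# the Liu–Zhang–Zhang fact (H2@3) + TL₃

Cell `bsd-stepL` (run/shared/lean/pub/bsd-stepL/), seat `bsd-stepL-bdp` (prover g19, 2026-08-27).
`--supports stmt-BirchSwinnertonDyer-19109 --as helper`. The by-name wrapper of the Theses-free
`Theorems/ClassRecordThreeEulerHalvesAtThreeFromUB[NotRam].lean` (bdp g19). Inputs: the route's own published-inputs item
(`ClassRecordThree.PublishedInputsThree` 19112 = K2@3 `closes` binder h₆, resp. `KolyvaginRoadThree.PublishedInputsKolyThree`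
= KOLY binder h₇; conjuncts used: Gross–Zagier, Kolyvagin, Skinner Thm C, GZK, modularity ×2, Hoffstein–Luo, Mazur); the
PUBLISHED Literature facts `JetchevSkinnerWan2017.thm331_anticyclotomicControl_mult` (control at a multiplicative `p ≥ 3`;
item 19626 on K2, not yet an item on the @3 routes) and `LiuZhangZhang2018.thm151_thm153_modularCurve_heegnerVector`
(H2@3 for every curve, thmc-p1 g8 `LZZKernel.bdpValueAt₃_of_thm151_thm153`; RULING 18's planned support `LZZWaldspurgerHeegner`);
the typed input UB∃ᴮ@3 on X11b@3 (inline: `Three.BDPExistsAt₃` with the REVERSED inclusion of `Three.IMCDivAt₃B` attached —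
SOURCELESS at `p = 3`); and TL₃ = the registered stub `stub_twistLowerAtThree` of 19109's birth skeleton VERBATIM.

AS A ROAD (second line next to tam3-p1's registered Jetchev line, whose open stubs are supplyAtThree ∕ J₃ʳ♭-multi ∕
J₃⁰♭-multi ∕ TL₃): 19109 ⟸ {UB∃ᴮ@3, TL₃, 19112, thm331_mult (PUB), LZZ (PUB)} — uniform in the carrier count (the SUM form
of the Tamagawa term, which Kolyvagin-system methods in print do not reach), no `3`-adic height, no Shimura curve.

HONEST FRAMING: implication only; UB∃ᴮ@3 has NO source at `p = 3` (the cell's memo proof of UB is `p ≥ 5`); TL₃ open; item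
19109 is NOT closed; nothing booked or re-labelled (T7); BSD proved for no curve.

References: [JetchevSkinnerWan2017] Thm. 3.3.1, §7.4.2; [LiuZhangZhang2018] Thms. 1.5.1, 1.5.3; [Castella2018] Thms. 2.3,
3.1, 3.2, §5; [Skinner2016PacificMC] Thm. C; [Miller2011LMS] Def. 1.1.
-/

set_option autoImplicit false
set_option linter.dupNamespace false

noncomputable section

open scoped Classical NumberField

open WeierstrassCurve NumberField IsDedekindDomain Field PowerSeries
open Literature.NumberTheory.EllipticCurves
open Literature.NumberTheory.EllipticCurves.ModularForms
open Literature.NumberTheory.EllipticCurves.Rank1Residual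
open Literature.NumberTheory.EllipticCurves.Rank1Residual.Typed
open Literature.NumberTheory.EllipticCurves.JetchevSkinnerWan2017
open Literature.NumberTheory.GaloisRepresentations Literature.NumberTheory.GaloisCohomology
open Literature.NumberTheory.Automorphic
open Summit.BirchSwinnertonDyer.Rank1Residual Summit.BirchSwinnertonDyer.Rank1Residual.X11b
open Summit.BirchSwinnertonDyer.Rank1Residual.X11b.AcSelmer
open Summit.BirchSwinnertonDyer.Rank1Residual.X11b.Halves
open Summit.BirchSwinnertonDyer.Rank1Residual.X11b.Three

namespace Summit.BirchSwinnertonDyer.BirchSwinnertonDyer.Theorems.EulerHalfUB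

/-- **K2@3: `ClassRecordThree.EulerHalvesAtThree` BY NAME** from `PublishedInputsThree` (item 19112, `closes` binder h₆), the JSW
control fact, the LZZ fact (H2@3), UB∃ᴮ@3 on X11b@3 and TL₃. One line over `eulerHalvesAtThree_body_of_ubB₃`. CONDITIONAL on
UB∃ᴮ@3 (sourceless at 3) and TL₃; item 19109 NOT closed; nothing booked.
[cite: JetchevSkinnerWan2017, Thm. 3.3.1 and §7.4.2 (arXiv:1512.06894 pp. 11, 31)]
[cite: LiuZhangZhang2018, Thm. 1.5.1 and Thm. 1.5.3 (Duke Math. J. 167 (2018) pp. 745–749)] [cite: Miller2011LMS, Def. 1.1] -/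
theorem classRecordThree_eulerHalvesAtThree_of_ubB₃_of_items
    (h₆ : Summit.BirchSwinnertonDyer.BirchSwinnertonDyer.Theses.ClassRecordThree.PublishedInputsThree)
    (h331 : thm331_anticyclotomicControl_mult)
    (hLZZ : LiuZhangZhang2018.thm151_thm153_modularCurve_heegnerVector)
    (hUB : ∀ (W : WeierstrassCurve ℚ) [W.IsElliptic] [W.IsGloballyMinimal], ClassX11b W 3 →
      ∀ (N : ℕ) [NeZero N] (K : Type) [Field K] [NumberField K] (Dt : ModularParametrizationData W N)
      (H : HeegnerDatum N (NumberField.discr K)) (ι : K →+* ℂ) (P : (W.baseChange K).toAffine.Point),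
      ClassX11b W 3 → Surj W 3 → W.conductorNorm ℤ = N → IsImaginaryQuadratic K →
      Odd (NumberField.discr K) → SatisfiesHeegnerHypothesis N K →
      (W.quadraticTwist (NumberField.discr K : ℚ)).entireLFunction 1 ≠ 0 →
      WeierstrassCurve.Affine.Point.map ι.toRatAlgHom P = heegnerPointComplex Dt H →
      ¬ (3 : ℤ) ∣ Dt.c → ¬ IsOfFinAddOrder P →
      ∀ (κ : ZpExtension K 3), κ.IsAnticyclotomic →
        ∀ (γ : Field.absoluteGaloisGroup K) [Fact (κ.IsTopGenerator γ)]
          (𝔭 : HeightOneSpectrum (𝓞 K)), ((3 : ℕ) : 𝓞 K) ∈ 𝔭.asIdeal →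
          𝔭.asIdeal.ramificationIdx (𝓞 ℚ) = 1 → 𝔭.asIdeal.inertiaDeg (𝓞 ℚ) = 1 →
          ∀ (f : CuspForm (CongruenceSubgroup.Gamma0 N) 2), IsNewformOf W f →
            ∃ ι' : PadicAlgCl 3 ≃+* ℂ, InducesPrime ι' 𝔭 ∧
              ∃ (ΩK : ℂ) (Ωp : (unrIntegers 3)ˣ) (L : UnrSeries 3),
                ΩK ≠ 0 ∧ IsBDPLFunction ι' 𝔭 κ γ f ΩK ((Ωp : unrIntegers 3) : ℂ_[3]) L ∧
                ∀ (𝔭bar : HeightOneSpectrum (𝓞 K)), ((3 : ℕ) : 𝓞 K) ∈ 𝔭bar.asIdeal → 𝔭bar ≠ 𝔭 →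
                  Ideal.span {L} ≤
                    (XAc.charIdeal (W.baseChange K) 3 κ 𝔭bar ∅ γ).map (PowerSeries.map (toUnr 3)))
    -- TL₃: the registered stub `stub_twistLowerAtThree` of 19109's birth skeleton, VERBATIM
    (hTL : ∀ (V : WeierstrassCurve ℚ) [V.IsElliptic] [V.IsGloballyMinimal],
      V.HasMultiplicativeReductionAtPrime 3 → V.HasIrreducibleModPGaloisRep 3 →
      V.entireLFunction 1 ≠ 0 → Finite V.sha →
      ∃ q : ℚ, V.entireLFunction 1 / (V.realPeriodRat : ℂ) = (q : ℂ) ∧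
        padicValRat 3 q ≤ (padicValNat 3 V.shaOrder : ℤ) + padicValNat 3 V.tamagawaProduct -
          2 * padicValNat 3 V.torsionOrder) :
    Summit.BirchSwinnertonDyer.BirchSwinnertonDyer.Theses.ClassRecordThree.EulerHalvesAtThree := by
  obtain ⟨hGZ, hKo, -, hSk, -, hGZK, hmod, hnf, hHL, hMaz, -, -, -, -, -, -, -, -, -, -⟩ := h₆
  exact eulerHalvesAtThree_body_of_ubB₃ h331 hGZ hKo hGZK hmod hnf hHL hMaz hSk
    (fun W _ _ _ ↦ LZZKernel.bdpValueAt₃_of_thm151_thm153 hLZZ W) hUB hTL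

/-- **KOLY: `KolyvaginRoadThree.EulerHalvesAtThree` BY NAME** from `PublishedInputsKolyThree` (the route's `closes` binder h₇),
the JSW control fact, the LZZ fact, UB∃ᴮ@3 on X11b@3 and TL₃. Same body (the two route decls are byte-identical).
CONDITIONAL on UB∃ᴮ@3 (sourceless at 3) and TL₃; item 19109 NOT closed; nothing booked.
[cite: JetchevSkinnerWan2017, Thm. 3.3.1 and §7.4.2 (arXiv:1512.06894 pp. 11, 31)]
[cite: LiuZhangZhang2018, Thm. 1.5.1 and Thm. 1.5.3 (Duke Math. J. 167 (2018) pp. 745–749)] [cite: Miller2011LMS, Def. 1.1] -/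
theorem kolyvaginRoadThree_eulerHalvesAtThree_of_ubB₃_of_items
    (h₇ : Summit.BirchSwinnertonDyer.BirchSwinnertonDyer.Theses.KolyvaginRoadThree.PublishedInputsKolyThree)
    (h331 : thm331_anticyclotomicControl_mult)
    (hLZZ : LiuZhangZhang2018.thm151_thm153_modularCurve_heegnerVector)
    (hUB : ∀ (W : WeierstrassCurve ℚ) [W.IsElliptic] [W.IsGloballyMinimal], ClassX11b W 3 →
      ∀ (N : ℕ) [NeZero N] (K : Type) [Field K] [NumberField K] (Dt : ModularParametrizationData W N)
      (H : HeegnerDatum N (NumberField.discr K)) (ι : K →+* ℂ) (P : (W.baseChange K).toAffine.Point),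
      ClassX11b W 3 → Surj W 3 → W.conductorNorm ℤ = N → IsImaginaryQuadratic K →
      Odd (NumberField.discr K) → SatisfiesHeegnerHypothesis N K →
      (W.quadraticTwist (NumberField.discr K : ℚ)).entireLFunction 1 ≠ 0 →
      WeierstrassCurve.Affine.Point.map ι.toRatAlgHom P = heegnerPointComplex Dt H →
      ¬ (3 : ℤ) ∣ Dt.c → ¬ IsOfFinAddOrder P →
      ∀ (κ : ZpExtension K 3), κ.IsAnticyclotomic →
        ∀ (γ : Field.absoluteGaloisGroup K) [Fact (κ.IsTopGenerator γ)]
          (𝔭 : HeightOneSpectrum (𝓞 K)), ((3 : ℕ) : 𝓞 K) ∈ 𝔭.asIdeal →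
          𝔭.asIdeal.ramificationIdx (𝓞 ℚ) = 1 → 𝔭.asIdeal.inertiaDeg (𝓞 ℚ) = 1 →
          ∀ (f : CuspForm (CongruenceSubgroup.Gamma0 N) 2), IsNewformOf W f →
            ∃ ι' : PadicAlgCl 3 ≃+* ℂ, InducesPrime ι' 𝔭 ∧
              ∃ (ΩK : ℂ) (Ωp : (unrIntegers 3)ˣ) (L : UnrSeries 3),
                ΩK ≠ 0 ∧ IsBDPLFunction ι' 𝔭 κ γ f ΩK ((Ωp : unrIntegers 3) : ℂ_[3]) L ∧
                ∀ (𝔭bar : HeightOneSpectrum (𝓞 K)), ((3 : ℕ) : 𝓞 K) ∈ 𝔭bar.asIdeal → 𝔭bar ≠ 𝔭 →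
                  Ideal.span {L} ≤
                    (XAc.charIdeal (W.baseChange K) 3 κ 𝔭bar ∅ γ).map (PowerSeries.map (toUnr 3)))
    -- TL₃: the registered stub `stub_twistLowerAtThree` of 19109's birth skeleton, VERBATIM
    (hTL : ∀ (V : WeierstrassCurve ℚ) [V.IsElliptic] [V.IsGloballyMinimal],
      V.HasMultiplicativeReductionAtPrime 3 → V.HasIrreducibleModPGaloisRep 3 →
      V.entireLFunction 1 ≠ 0 → Finite V.sha →
      ∃ q : ℚ, V.entireLFunction 1 / (V.realPeriodRat : ℂ) = (q : ℂ) ∧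
        padicValRat 3 q ≤ (padicValNat 3 V.shaOrder : ℤ) + padicValNat 3 V.tamagawaProduct -
          2 * padicValNat 3 V.torsionOrder) :
    Summit.BirchSwinnertonDyer.BirchSwinnertonDyer.Theses.KolyvaginRoadThree.EulerHalvesAtThree := by
  obtain ⟨⟨hGZ, hKo, -, hSk, -, hGZK, hmod, hnf, hHL, hMaz, -, -, -, -, -, -, -, -, -, -⟩, -, -, -⟩ := h₇
  exact eulerHalvesAtThree_body_of_ubB₃ h331 hGZ hKo hGZK hmod hnf hHL hMaz hSk
    (fun W _ _ _ ↦ LZZKernel.bdpValueAt₃_of_thm151_thm153 hLZZ W) hUB hTL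

end Summit.BirchSwinnertonDyer.BirchSwinnertonDyer.Theorems.EulerHalfUB

end
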